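import Literature.NumberTheory.Sieve.FordMaynardFragmentationBridge
import Literature.NumberTheory.Sieve.FordMaynardFragmentationTzeroPrep
import HarnessLib

/-!
# Ford–Maynard, Theorem 6.4: preparations for the symmetrisation of block products of `𝓛`

Everything here is PROVED. Sixth file towards Theorem 6.4 of K. Ford, J. Maynard,
*On the theory of prime producing sieves* (arXiv:2407.14368), serving the converse direction
(6.3) ⇒ (TypeI-f) (§6.1, last paragraph: "we may replace the factor `𝓛(v₁)⋯𝓛(v_s)` by its
symmetric average ... By Lemma 5.4 the sum on `s` equals zero"). The symmetric average is taken in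
the next file by induction on the number of blocks, two blocks at a time; here are the pieces:

* `sliceIntegral_append'`: the two-block Fubini formula of `FordMaynardSliceBlocks` for arbitrary
  block dimensions `n₁, n₂ ≥ 1`;
* block bookkeeping for a flat vector `β ∈ ℝ^{bsum (s+1) h}`: its last block is `β ∘ natAdd`, its
  earlier blocks are those of `β ∘ castAdd` (`apply_cast_finSigmaFinEquiv_last'`,
  `apply_cast_finSigmaFinEquiv_castSucc'`), whence the product `∏_j 𝓛_c(β_j)/h_j!` peels
  (`linnikProd_peel`);
* naturality of `𝓛_c` and its convolution powers along `castAdd`, `natAdd` and casts, the images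
  of the initial segments `{i < q}` (`map_filter_lt_finCongr`), crude bounds;
* the auxiliary functions `Ψ̃(v) = ∫_{z ∈ Δ_b(w)} 𝓛_c(z)/b! · Ψ(v, z) dz` obtained by integrating
  out a last block: symmetric, measurable, bounded (`psiAux_symm`, `measurable_psiAux`,
  `abs_psiAux_le`).

## References

* K. Ford, J. Maynard, *On the theory of prime producing sieves*, arXiv:2407.14368 (2024), §6.1
  (proof of Theorem 6.4, (6.3) ⇒ (TypeI-f)). [FordMaynard2024PrimeSieves]
-/

noncomputable section

open MeasureTheory Finset Literature.Combinatorics.Enumerative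

namespace Literature.NumberTheory.Sieve.FordMaynard

/-! ### Two-block Fubini for arbitrary positive block dimensions -/

/-- **Two-block Fubini formula** for block dimensions `n₁, n₂ ≥ 1`:
`∫_{Δ_{n₁+n₂}(w)} G = ∫_0^w ∫_{v ∈ Δ_{n₁}(τ)} ∫_{z ∈ Δ_{n₂}(w−τ)} G(v, z) dτ`. [folklore] -/
theorem sliceIntegral_append' {n₁ n₂ : ℕ} (h₁ : 1 ≤ n₁) (h₂ : 1 ≤ n₂) (w : ℝ)
    (G : (Fin (n₁ + n₂) → ℝ) → ℝ) (hG : Measurable G) {C : ℝ} (hC : 0 ≤ C) (hGb : ∀ x, |G x| ≤ C) :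
    sliceIntegral (n₁ + n₂) w G = ∫ τ in Set.Ioc 0 w, sliceIntegral n₁ τ
      (fun v => sliceIntegral n₂ (w - τ) (fun z => G (Fin.append v z))) := by
  obtain ⟨a, rfl⟩ : ∃ a, n₁ = a + 1 := ⟨n₁ - 1, by omega⟩
  obtain ⟨b, rfl⟩ : ∃ b, n₂ = b + 1 := ⟨n₂ - 1, by omega⟩
  exact sliceIntegral_append a b w G hG hC hGb

/-! ### Blocks of a flat vector of dimension `bsum (s+1) h` -/

/-- The `i`-th entry of the last block of `β ∈ ℝ^{bsum (s+1) h}` is `β (natAdd _ i)`. [folklore] -/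
theorem apply_cast_finSigmaFinEquiv_last' {s : ℕ} (h : Fin (s + 1) → ℕ)
    (β : Fin (bsum (s + 1) h) → ℝ) (i : Fin (h (Fin.last s))) :
    β (Fin.cast (bsum_eq_sum (s + 1) h).symm (finSigmaFinEquiv (n := h) ⟨Fin.last s, i⟩)) =
      β (Fin.natAdd (bsum s (Fin.init h)) i) := by
  refine congrArg β (Fin.ext ?_)
  simp only [Fin.val_cast, val_finSigmaFinEquiv_last, Fin.val_natAdd, bsum_eq_sum]
  rfl

/-- The `i`-th entry of block `j < s` of `β ∈ ℝ^{bsum (s+1) h}` is the corresponding entry of the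
first part `β ∘ castAdd`. [folklore] -/
theorem apply_cast_finSigmaFinEquiv_castSucc' {s : ℕ} (h : Fin (s + 1) → ℕ)
    (β : Fin (bsum (s + 1) h) → ℝ) (j : Fin s) (i : Fin (h (Fin.castSucc j))) :
    β (Fin.cast (bsum_eq_sum (s + 1) h).symm (finSigmaFinEquiv (n := h) ⟨Fin.castSucc j, i⟩)) =
      β (Fin.castAdd (h (Fin.last s))
        (Fin.cast (bsum_eq_sum s (Fin.init h)).symm (finSigmaFinEquiv (n := Fin.init h) ⟨j, i⟩))) := by
  refine congrArg β (Fin.ext ?_)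
  simp only [Fin.val_cast, val_finSigmaFinEquiv_castSucc, Fin.val_castAdd]

/-- **Peeling the product of Linnik factors**: for `β ∈ ℝ^{bsum (s+1) h}`,
`∏_{j ≤ s} 𝓛_c(β_j)/h_j! = (∏_{j < s} 𝓛_c((β ∘ castAdd)_j)/h_j!) · 𝓛_c(β ∘ natAdd)/h_s!`.
[folklore] -/
theorem linnikProd_peel (c : ℝ) {s : ℕ} (h : Fin (s + 1) → ℕ) (β : Fin (bsum (s + 1) h) → ℝ) :
    (∏ j : Fin (s + 1), linnikFn c (fun i =>
        β (Fin.cast (bsum_eq_sum (s + 1) h).symm (finSigmaFinEquiv (n := h) ⟨j, i⟩))) univ /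
          ((h j).factorial : ℝ)) =
      (∏ j : Fin s, linnikFn c (fun i => β (Fin.castAdd (h (Fin.last s))
          (Fin.cast (bsum_eq_sum s (Fin.init h)).symm (finSigmaFinEquiv (n := Fin.init h) ⟨j, i⟩)))) univ /
            ((Fin.init h j).factorial : ℝ)) *
        (linnikFn c (fun i => β (Fin.natAdd (bsum s (Fin.init h)) i)) univ /
          ((h (Fin.last s)).factorial : ℝ)) := by
  rw [Fin.prod_univ_castSucc]
  congr 1
  · refine Finset.prod_congr rfl fun j _ => ?_
    show linnikFn c _ univ / ((h (Fin.castSucc j)).factorial : ℝ) =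
      linnikFn c _ univ / ((h (Fin.castSucc j)).factorial : ℝ)
    congr 2
    funext i
    exact apply_cast_finSigmaFinEquiv_castSucc' h β j i
  · congr 2
    funext i
    exact apply_cast_finSigmaFinEquiv_last' h β i

/-- On `Fin.append v z`, the first part `· ∘ castAdd` is `v`. [folklore] -/
theorem append_castAdd_eq {a b : ℕ} (v : Fin a → ℝ) (z : Fin b → ℝ) :
    (fun i => Fin.append v z (Fin.castAdd b i)) = v :=
  funext fun i => Fin.append_left v z i

/-- On `Fin.append v z`, the last block `· ∘ natAdd` is `z`. [folklore] -/
theorem append_natAdd_eq {a b : ℕ} (v : Fin a → ℝ) (z : Fin b → ℝ) :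
    (fun i => Fin.append v z (Fin.natAdd a i)) = z :=
  funext fun i => Fin.append_right v z i

/-! ### Naturality and bounds for `𝓛_c` and its convolution powers -/

/-- `𝓛_c` of the first part of a vector, as a set function on subsets of the first block.
[folklore] -/
theorem linnikFn_castAdd {a b : ℕ} (c : ℝ) (β : Fin (a + b) → ℝ) (S : Finset (Fin a)) :
    linnikFn c (fun i => β (Fin.castAdd b i)) S = linnikFn c β (S.map (Fin.castAddEmb b)) :=
  linnikFn_map (Fin.castAddEmb b) c β S

/-- `𝓛_c` of the last block of a vector. [folklore] -/
theorem linnikFn_natAdd {a b : ℕ} (c : ℝ) (β : Fin (a + b) → ℝ) (S : Finset (Fin b)) :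
    linnikFn c (fun i => β (Fin.natAdd a i)) S = linnikFn c β (S.map (Fin.natAddEmb a)) :=
  linnikFn_map (Fin.natAddEmb a) c β S

/-- Convolution powers of `𝓛_c` of the first part of a vector. [folklore] -/
theorem spow_linnikFn_castAdd {a b : ℕ} (c : ℝ) (β : Fin (a + b) → ℝ) (d : ℕ) (S : Finset (Fin a)) :
    spow (linnikFn c (fun i => β (Fin.castAdd b i))) d S =
      spow (linnikFn c β) d (S.map (Fin.castAddEmb b)) := by
  rw [← spow_comp_map (Fin.castAddEmb b) (linnikFn c β) d S]
  congr 1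
  funext B
  exact linnikFn_castAdd c β B

/-- `𝓛_c` under a cast of the dimension. [folklore] -/
theorem linnikFn_comp_cast {a a' : ℕ} (e : a = a') (c : ℝ) (β : Fin a' → ℝ) (S : Finset (Fin a)) :
    linnikFn c (β ∘ Fin.cast e) S = linnikFn c β (S.map (finCongr e).toEmbedding) :=
  linnikFn_map (finCongr e).toEmbedding c β S

/-- Convolution powers of `𝓛_c` under a cast of the dimension. [folklore] -/
theorem spow_linnikFn_comp_cast {a a' : ℕ} (e : a = a') (c : ℝ) (β : Fin a' → ℝ) (d : ℕ)
    (S : Finset (Fin a)) :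
    spow (linnikFn c (β ∘ Fin.cast e)) d S = spow (linnikFn c β) d (S.map (finCongr e).toEmbedding) := by
  rw [← spow_comp_map (finCongr e).toEmbedding (linnikFn c β) d S]
  congr 1
  funext B
  exact linnikFn_comp_cast e c β B

/-- The initial segment `{i < q}` is mapped to the initial segment by a cast. [folklore] -/
theorem map_filter_lt_finCongr {a a' : ℕ} (e : a = a') (q : ℕ) :
    (univ.filter fun i : Fin a => (i : ℕ) < q).map (finCongr e).toEmbedding =
      univ.filter fun i : Fin a' => (i : ℕ) < q := by
  subst e
  ext x
  simp

/-- The complement of the initial segment under a cast. [folklore] -/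
theorem map_sdiff_filter_lt_finCongr {a a' : ℕ} (e : a = a') (q : ℕ) :
    (univ \ univ.filter fun i : Fin a => (i : ℕ) < q).map (finCongr e).toEmbedding =
      univ \ univ.filter fun i : Fin a' => (i : ℕ) < q := by
  subst e
  ext x
  simp

/-- `|𝓛_c^{⋆d}(β_S)| ≤ (2^n · n (2^n)^n)^d` on `ℝ^n`. [folklore] -/
theorem abs_spow_linnikFn_le {n : ℕ} (c : ℝ) (β : Fin n → ℝ) (d : ℕ) (S : Finset (Fin n)) :
    |spow (linnikFn c β) d S| ≤ (2 ^ n * (n * (2 ^ n) ^ n)) ^ d := by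
  have h := abs_spow_le (F := linnikFn c β) (a := n * (2 ^ n) ^ n) (by positivity)
    (fun B => by simpa using abs_linnikFn_le c β B) d S
  simpa using h

/-- `u ↦ 𝓛_c^{⋆d}(u_S)` is measurable. [folklore] -/
theorem measurable_spow_linnikFn {n : ℕ} (c : ℝ) (d : ℕ) (S : Finset (Fin n)) :
    Measurable fun u : Fin n → ℝ => spow (linnikFn c u) d S :=
  measurable_spow (fun B => measurable_linnikFn c B) d S

/-! ### Integrating out a last block: the auxiliary functions `Ψ̃` -/

/-- **Symmetry of `Ψ̃`.** For `Ψ ∈ 𝒮`, the function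
`v ↦ ∫_{z ∈ Δ_b(w)} 𝓛_c(z)/b! Ψ(v, z) dz` on variable-length vectors `v` is again in `𝒮`.
[cite: FordMaynard2024PrimeSieves, Definition 6.1] -/
theorem psiAux_symm {Ψ : VecFn} (hΨ : Ψ.IsSymmetric) (c : ℝ) (b : ℕ) (w : ℝ) :
    VecFn.IsSymmetric (fun n v => sliceIntegral b w (fun z =>
      linnikFn c z univ / (b.factorial : ℝ) * Ψ (n + b) (Fin.append v z))) := by
  intro n σ v
  show sliceIntegral b w (fun z => linnikFn c z univ / (b.factorial : ℝ) * Ψ (n + b) (Fin.append (v ∘ σ) z)) =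
    sliceIntegral b w (fun z => linnikFn c z univ / (b.factorial : ℝ) * Ψ (n + b) (Fin.append v z))
  congr 1
  funext z
  rw [hΨ.append_perm_left]

/-- **Measurability of `Ψ̃`** (jointly in a real parameter entering the slice total). [folklore] -/
theorem measurable_psiAux_param {Ψ : VecFn} (hΨm : ∀ n, Measurable (Ψ n)) (c : ℝ) (b : ℕ)
    (t : ℝ) (n : ℕ) :
    Measurable fun q : ℝ × (Fin n → ℝ) => sliceIntegral b (t - q.1) (fun z =>
      linnikFn c z univ / (b.factorial : ℝ) * Ψ (n + b) (Fin.append q.2 z)) := by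
  refine measurable_sliceIntegral_param (X := ℝ × (Fin n → ℝ)) b (w := fun q => t - q.1)
    (measurable_const.sub measurable_fst) ?_
  exact (((measurable_linnikFn c univ).comp measurable_snd).div_const _).mul
    ((hΨm _).comp (measurable_finAppend.comp ((measurable_snd.comp measurable_fst).prodMk measurable_snd)))

/-- Measurability of `Ψ̃` for a fixed slice total. [folklore] -/
theorem measurable_psiAux {Ψ : VecFn} (hΨm : ∀ n, Measurable (Ψ n)) (c : ℝ) (b : ℕ) (w : ℝ)
    (n : ℕ) :
    Measurable fun v : Fin n → ℝ => sliceIntegral b w (fun z =>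
      linnikFn c z univ / (b.factorial : ℝ) * Ψ (n + b) (Fin.append v z)) := by
  refine measurable_sliceIntegral_param (X := Fin n → ℝ) b (w := fun _ => w) measurable_const ?_
  exact (((measurable_linnikFn c univ).comp measurable_snd).div_const _).mul
    ((hΨm _).comp measurable_finAppend)

/-- The integrand of `Ψ̃` is bounded by `b (2^b)^b / b! · B`. [folklore] -/
theorem abs_psiAux_integrand_le {Ψ : VecFn} {B : ℝ} (hΨb : ∀ n v, |Ψ n v| ≤ B) (c : ℝ) (b n : ℕ)
    (v : Fin n → ℝ) (z : Fin b → ℝ) :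
    |linnikFn c z univ / (b.factorial : ℝ) * Ψ (n + b) (Fin.append v z)| ≤
      b * (2 ^ b) ^ b / (b.factorial : ℝ) * B := by
  have hB0 : 0 ≤ B := (abs_nonneg _).trans (hΨb 0 Fin.elim0)
  rw [abs_mul, abs_div, Nat.abs_cast]
  have h1 := abs_linnikFn_le c z univ
  simp only [Fintype.card_fin] at h1
  exact mul_le_mul (div_le_div_of_nonneg_right h1 (by positivity)) (hΨb _ _) (abs_nonneg _)
    (by positivity)

/-- **A uniform bound for `Ψ̃`** (slice total `w ≤ R`, `R ≥ 1`):
`|Ψ̃(v)| ≤ b (2^b)^b/b! · B · R^b`. [folklore] -/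
theorem abs_psiAux_le {Ψ : VecFn} {B : ℝ} (hΨb : ∀ n v, |Ψ n v| ≤ B) (c : ℝ) (b : ℕ) {w R : ℝ}
    (hR : 1 ≤ R) (hwR : w ≤ R) (n : ℕ) (v : Fin n → ℝ) :
    |sliceIntegral b w (fun z => linnikFn c z univ / (b.factorial : ℝ) * Ψ (n + b) (Fin.append v z))| ≤
      b * (2 ^ b) ^ b / (b.factorial : ℝ) * B * R ^ b := by
  have hB0 : 0 ≤ B := (abs_nonneg _).trans (hΨb 0 Fin.elim0)
  exact abs_sliceIntegral_le_pow b hR hwR (by positivity) fun z => abs_psiAux_integrand_le hΨb c b n v z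

/-! ### The two-block integrand of the symmetrised side -/

/-- Measurability of `β ↦ Ψ(β) 𝓛^{⋆d}(β_S) 𝓛(β_{S'})`. [folklore] -/
theorem measurable_symmIntegrand {n : ℕ} {Ψn : (Fin n → ℝ) → ℝ} (hΨ : Measurable Ψn) (c : ℝ)
    (d : ℕ) (S S' : Finset (Fin n)) :
    Measurable fun β : Fin n → ℝ => Ψn β * (spow (linnikFn c β) d S * linnikFn c β S') :=
  hΨ.mul ((measurable_spow_linnikFn c d S).mul (measurable_linnikFn c S'))

/-- A bound for `β ↦ Ψ(β) 𝓛^{⋆d}(β_S) 𝓛(β_{S'})`. [folklore] -/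
theorem abs_symmIntegrand_le {n : ℕ} {Ψn : (Fin n → ℝ) → ℝ} {B : ℝ} (hΨb : ∀ β, |Ψn β| ≤ B)
    (c : ℝ) (d : ℕ) (S S' : Finset (Fin n)) (β : Fin n → ℝ) :
    |Ψn β * (spow (linnikFn c β) d S * linnikFn c β S')| ≤
      B * ((2 ^ n * (n * (2 ^ n) ^ n)) ^ d * (n * (2 ^ n) ^ n)) := by
  have hB0 : 0 ≤ B := (abs_nonneg _).trans (hΨb β)
  rw [abs_mul, abs_mul]
  have h2 := abs_linnikFn_le c β S'
  simp only [Fintype.card_fin] at h2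
  exact mul_le_mul (hΨb β) (mul_le_mul (abs_spow_linnikFn_le c β d S) h2 (abs_nonneg _)
    (by positivity)) (by positivity) hB0

end Literature.NumberTheory.Sieve.FordMaynard
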